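import Literature.MathematicalPhysics.QuantumLattice.HubbardBandShellVolume
import HarnessLib

/-!
# The nodal shell-volume estimate for the `d`-wave BdG band: `|BZ ∩ {ξ² + Δ²d² < t²}| ≤ C t²/Δ`

Topic `Literature/MathematicalPhysics/QuantumLattice`; continues `HubbardBandShellVolume`
(`exists_shellVolume_le`: the energy shell `BZ ∩ {|ε - μ| < t}` of the square-lattice band
`ε(k) = -2(cos k₁ + cos k₂)` has measure `≤ C_sh t` for levels in a compact sub-band of `(-4, 0)`).

Here the band is dressed with a `d`-wave (B₁g) gap `Δ · d(k)`, `d(k) = cos k₁ - cos k₂`: the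
Bogoliubov–de Gennes quasi-particle energy `E(k) = √((ε(k) - μ)² + Δ² d(k)²)` vanishes only at the
four NODES where the Fermi curve `{ε = μ}` crosses the diagonals `k₁ = ±k₂`, linearly in the distance
to the node ("Dirac cones"), so the low-energy phase space is quadratic in the energy and inversely
proportional to the gap amplitude — the linear nodal density of states of a `d`-wave superconductor:

* `mul_abs_le_abs_sin` — the chord bound `(sin m / π)|x| ≤ |sin x|` on `|x| ≤ π - m`;
* `exists_mul_abs_cos_two_mul_le_abs_dWave` — **the `d`-wave factor in polar coordinates dominates
  the distance to the diagonals**: for points `k = r (cos θ, sin θ)` of the square `[-π, π]²` with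
  `a ≤ ε(k) ≤ b` (`-4 < a`, `b < 0`) one has `κ |cos 2θ| ≤ |d(k)|`, `κ = κ(a, b) > 0` — from the exact
  factorisation `cos k₁ - cos k₂ = -2 sin((k₁+k₂)/2) sin((k₁-k₂)/2)`, the margins `|kᵢ| ≤ π - m`,
  `r² ≥ a + 4` forced by the level, and `(k₁² - k₂²) = r² cos 2θ`;
* `abs_lt_of_abs_cos_two_mul_lt`, `volume_abs_cos_two_mul_lt_le` — the angular set
  `{θ ∈ (-π, π) : |cos 2θ| < η}` lies within `πη/4` of the four diagonal directions `±π/4, ±3π/4`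
  (Jordan's inequality), hence has measure `≤ 2πη`;
* `exists_nodalShellVolume_le` — **the nodal shell-volume estimate**: for `[μ₁, μ₂] ⊂ (-4, 0)` and
  `Δ₀ > 0` there is `C ≥ 0` with
  `vol(BZ ∩ {(ε - μ)² + Δ² d² < t²}) ≤ C t²/Δ` for all `μ ∈ [μ₁, μ₂]`, `0 < Δ ≤ Δ₀`, `t > 0`.
  Proof: for small `t` the set lies, in polar coordinates, in the radial window
  `u_{μ-t}(θ) < r < u_{μ+t}(θ)` of `HubbardBandShellVolume` (width `≤ 2Lt`) AND in the angular set
  `|cos 2θ| < t/(Δκ)` (measure `≤ 2πt/(Δκ)`), so its area is `≤ 8 · 2Lt · 2πt/(Δκ)`; for `t ≥ t₀`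
  the bound `vol(BZ) · Δ₀ t²/(t₀² Δ)` is trivial. (The cap `Δ ≤ Δ₀` is needed: for `Δ → ∞` at fixed
  large `t` the set degenerates to a neighbourhood of the diagonals through the saddle of `d` at
  `k = 0`, of area `≍ (t/Δ) log(Δ/t)`.)
* `exists_planarNodalShellVolume_le`, `exists_planarNodalShellVolume_le_twoPi` — the same for the
  planar sets over `[-π, π)²` and over the period square `[0, 2π)²` (four `2π`-translates, constant `4C`);
* `exists_planarNodalShellVolume_le_dWaveSource` — the same in the normalisation of the `d`-wave pair
  source of the tree (`DWaveSourceFreePressure`: gap `2√2 h d(k)`, Brillouin-zone averages over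
  `[0, 2π)²`), `vol ≤ C t²/|h|` for `0 < |h| ≤ h₀`.

This is the geometric input of the infrared power counting at the nodes (Dirac-cone scaling) and of
the `T²`-laws of the free `d`-wave thermodynamics (by the layer-cake formula, e.g.
`∫_{BZ} e^{-βE} ≤ 2C/(Δβ²)`). Everything is proved; no definitions. [folklore]

## Sources

Folklore (nodal `d`-wave quasi-particles: P. A. Lee, Phys. Rev. Lett. 71 (1993) 1887; A. C. Durst,
P. A. Lee, Phys. Rev. B 62 (2000) 1270, §II, `E_k ≃ √(v_F² k₁² + v_Δ² k₂²)`, `N(E) ∝ E/(v_F v_Δ)`);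
the polar description of the Fermi curve is that of G. Benfatto, A. Giuliani, V. Mastropietro,
Ann. Henri Poincaré 7 (2006) 809, §1 (`BenfattoGiulianiMastropietro2006`), as set up in
`HubbardFermiRadiusBand*` / `HubbardBandShellVolume`.

## Mathlib / tree search

`lean search "nodal|cos_two_mul.*volume|ShellVolume"` — only `HubbardBandShellVolume.exists_shellVolume_le`
(no gap) and the discrete non-nodal count `DWaveGapLatticeCount.exists_card_dWaveGap_ge`; nothing on
the BdG band.
-/

noncomputable section

open Real Set Filter MeasureTheory MeasureTheory.Measure
open scoped Topology ENNReal

namespace Literature.MathematicalPhysics.QuantumLattice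

/-! ### Elementary trigonometric inequalities -/

/-- **Chord bound for the sine**: for `0 < m ≤ 1` and `|x| ≤ π - m`, `(sin m / π) |x| ≤ |sin x|`
(Jordan's inequality on `[0, π/2]`, monotonicity of `sin` on `[π/2, π - m]`). [folklore] -/
theorem mul_abs_le_abs_sin {m x : ℝ} (hm0 : 0 < m) (hm1 : m ≤ 1) (hx : |x| ≤ π - m) :
    Real.sin m / π * |x| ≤ |Real.sin x| := by
  obtain ⟨hπ0, hπ⟩ : (0 : ℝ) < π ∧ (2 : ℝ) ≤ π := ⟨Real.pi_pos, Real.two_le_pi⟩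
  have hxπ : |x| ≤ π := by linarith
  -- `|sin x| = sin |x|` (`Literature.Probability.LatticeModels.abs_sin_eq_sin_abs`, inlined to keep the
  -- import graph of the Fermi-geometry files light)
  have habs : |Real.sin x| = Real.sin |x| := by
    have h0 : 0 ≤ Real.sin |x| := Real.sin_nonneg_of_nonneg_of_le_pi (abs_nonneg x) hxπ
    rcases le_total 0 x with hx0 | hx0
    · rw [abs_of_nonneg hx0] at h0 ⊢
      exact abs_of_nonneg h0
    · rw [abs_of_nonpos hx0] at h0 ⊢
      rw [Real.sin_neg] at h0 ⊢
      exact abs_of_nonpos (by linarith)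
  rw [habs]
  have hsm1 : Real.sin m ≤ 1 := Real.sin_le_one m
  have hsm0 : 0 ≤ Real.sin m := Real.sin_nonneg_of_nonneg_of_le_pi hm0.le (by linarith)
  rcases le_or_gt |x| (π / 2) with h | h
  · have hJ := Real.mul_le_sin (abs_nonneg x) h
    calc Real.sin m / π * |x| ≤ 2 / π * |x| := by
          apply mul_le_mul_of_nonneg_right _ (abs_nonneg x)
          exact div_le_div_of_nonneg_right (by linarith) hπ0.le
      _ ≤ Real.sin |x| := hJ
  · have h1 : Real.sin |x| = Real.sin (π - |x|) := (Real.sin_pi_sub _).symm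
    rw [h1]
    have h2 : Real.sin m ≤ Real.sin (π - |x|) :=
      Real.sin_le_sin_of_le_of_le_pi_div_two (by linarith) (by linarith) (by linarith)
    calc Real.sin m / π * |x| ≤ Real.sin m / π * π :=
          mul_le_mul_of_nonneg_left hxπ (div_nonneg hsm0 hπ0.le)
      _ = Real.sin m := by field_simp
      _ ≤ Real.sin (π - |x|) := h2

/-- A coordinate of a point of the square `[-π, π]²` whose band energy is `≤ b < 0` stays away from
`±π`: if `|k| ≤ π`, `cos k' ≤ 1` is all that is used of the other coordinate, `0 < m ≤ 1`,
`m² ≤ -b` and `-2(cos k + cos k') ≤ b`, then `|k| ≤ π - m`. [folklore] -/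
theorem abs_le_pi_sub_of_band_le {k k' m b : ℝ} (hk : |k| ≤ π) (hm1 : m ≤ 1)
    (hmb : m ^ 2 ≤ -b) (h : -2 * (Real.cos k + Real.cos k') ≤ b) : |k| ≤ π - m := by
  obtain ⟨hπ0, hπ⟩ : (0 : ℝ) < π ∧ (2 : ℝ) ≤ π := ⟨Real.pi_pos, Real.two_le_pi⟩
  by_contra H
  rw [not_le] at H
  have hcos : Real.cos |k| < Real.cos (π - m) :=
    Real.cos_lt_cos_of_nonneg_of_le_pi (by linarith) hk H
  rw [Real.cos_abs, Real.cos_pi_sub] at hcos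
  have hcm : 1 - m ^ 2 / 2 ≤ Real.cos m := Real.one_sub_sq_div_two_le_cos
  have hk' : Real.cos k' ≤ 1 := Real.cos_le_one k'
  linarith

/-- A point of the plane with band energy `≥ a` has `r² = k₁² + k₂² ≥ a + 4`
(`cos kᵢ ≥ 1 - kᵢ²/2`). [folklore] -/
theorem add_four_le_sq_of_le_band {a r θ : ℝ}
    (h : a ≤ -2 * (Real.cos (r * Real.cos θ) + Real.cos (r * Real.sin θ))) : a + 4 ≤ r ^ 2 := by
  have h1 : 1 - (r * Real.cos θ) ^ 2 / 2 ≤ Real.cos (r * Real.cos θ) := Real.one_sub_sq_div_two_le_cos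
  have h2 : 1 - (r * Real.sin θ) ^ 2 / 2 ≤ Real.cos (r * Real.sin θ) := Real.one_sub_sq_div_two_le_cos
  have h3 : (r * Real.cos θ) ^ 2 + (r * Real.sin θ) ^ 2 = r ^ 2 := by
    have := Real.cos_sq_add_sin_sq θ
    nlinarith [this]
  nlinarith

/-! ### The `d`-wave factor dominates the distance to the diagonals -/

/-- **The `d`-wave factor in polar coordinates dominates `|cos 2θ|`.** For `-4 < a` and `b < 0` there
is `κ > 0` such that every point `k = (r cos θ, r sin θ)` (`r ≥ 0`) of the square `|kᵢ| ≤ π` with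
`a ≤ ε(k) ≤ b` satisfies `κ |cos 2θ| ≤ |cos k₁ - cos k₂|`. Proof: `|kᵢ| ≤ π - m` and `r² ≥ a + 4`
by the level constraints; `cos k₁ - cos k₂ = -2 sin((k₁+k₂)/2) sin((k₁-k₂)/2)` with both arguments in
`[-(π - m), π - m]`, where `|sin x| ≥ (sin m/π)|x|`; and `(k₁+k₂)(k₁-k₂) = r² cos 2θ`. [folklore] -/
theorem exists_mul_abs_cos_two_mul_le_abs_dWave {a b : ℝ} (ha : -4 < a) (hb : b < 0) :
    ∃ κ : ℝ, 0 < κ ∧ ∀ r θ : ℝ, 0 ≤ r → |r * Real.cos θ| ≤ π → |r * Real.sin θ| ≤ π →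
      a ≤ -2 * (Real.cos (r * Real.cos θ) + Real.cos (r * Real.sin θ)) →
      -2 * (Real.cos (r * Real.cos θ) + Real.cos (r * Real.sin θ)) ≤ b →
      κ * |Real.cos (2 * θ)| ≤ |Real.cos (r * Real.cos θ) - Real.cos (r * Real.sin θ)| := by
  obtain ⟨hπ0, hπ⟩ : (0 : ℝ) < π ∧ (2 : ℝ) ≤ π := ⟨Real.pi_pos, Real.two_le_pi⟩
  set m : ℝ := min (Real.sqrt (-b)) 1 with hm
  have hm0 : 0 < m := lt_min (Real.sqrt_pos.2 (by linarith)) one_pos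
  have hm1 : m ≤ 1 := min_le_right _ _
  have hmb : m ^ 2 ≤ -b := by
    have h1 : m ≤ Real.sqrt (-b) := min_le_left _ _
    have h2 : Real.sqrt (-b) ^ 2 = -b := Real.sq_sqrt (by linarith)
    nlinarith [hm0.le]
  set c : ℝ := Real.sin m / π with hc
  have hc0 : 0 < c := div_pos (Real.sin_pos_of_pos_of_lt_pi hm0 (by linarith)) (by linarith)
  have ha4 : 0 < a + 4 := by linarith
  refine ⟨c ^ 2 * (a + 4) / 2, by positivity, fun r θ hr hx hy hlo hhi => ?_⟩
  set k₁ : ℝ := r * Real.cos θ with hk₁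
  set k₂ : ℝ := r * Real.sin θ with hk₂
  -- margins
  have h1 : |k₁| ≤ π - m := abs_le_pi_sub_of_band_le hx hm1 hmb hhi
  have h2 : |k₂| ≤ π - m :=
    abs_le_pi_sub_of_band_le hy hm1 hmb (by rwa [add_comm] at hhi)
  have hr2 : a + 4 ≤ r ^ 2 := add_four_le_sq_of_le_band hlo
  -- the two half-angles
  have h1' := abs_le.1 h1
  have h2' := abs_le.1 h2
  have hX : |(k₁ + k₂) / 2| ≤ π - m := abs_le.2 ⟨by linarith, by linarith⟩
  have hY : |(k₁ - k₂) / 2| ≤ π - m := abs_le.2 ⟨by linarith, by linarith⟩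
  have hsX := mul_abs_le_abs_sin hm0 hm1 hX
  have hsY := mul_abs_le_abs_sin hm0 hm1 hY
  have hd : Real.cos k₁ - Real.cos k₂ =
      -2 * Real.sin ((k₁ + k₂) / 2) * Real.sin ((k₁ - k₂) / 2) := Real.cos_sub_cos k₁ k₂
  have hprod : |(k₁ + k₂) / 2| * |(k₁ - k₂) / 2| = r ^ 2 * |Real.cos (2 * θ)| / 4 := by
    rw [← abs_mul, Real.cos_two_mul']
    have e : (k₁ + k₂) / 2 * ((k₁ - k₂) / 2) = r ^ 2 * (Real.cos θ ^ 2 - Real.sin θ ^ 2) / 4 := by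
      rw [hk₁, hk₂]; ring
    rw [e, abs_div, abs_mul, abs_of_nonneg (sq_nonneg r), abs_of_pos (by norm_num : (0:ℝ) < 4)]
  have hcX : 0 ≤ c * |(k₁ + k₂) / 2| := by positivity
  have hcY : 0 ≤ c * |(k₁ - k₂) / 2| := by positivity
  calc c ^ 2 * (a + 4) / 2 * |Real.cos (2 * θ)|
      ≤ c ^ 2 * r ^ 2 / 2 * |Real.cos (2 * θ)| := by gcongr
    _ = 2 * (c * |(k₁ + k₂) / 2|) * (c * |(k₁ - k₂) / 2|) := by
        have e : (c * |(k₁ + k₂) / 2|) * (c * |(k₁ - k₂) / 2|) = c ^ 2 * (|(k₁ + k₂) / 2| * |(k₁ - k₂) / 2|) := by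
          ring
        rw [mul_assoc, e, hprod]
        ring
    _ ≤ 2 * |Real.sin ((k₁ + k₂) / 2)| * |Real.sin ((k₁ - k₂) / 2)| := by gcongr
    _ = |Real.cos k₁ - Real.cos k₂| := by
        rw [hd, abs_mul, abs_mul, abs_neg, abs_two]

/-! ### The angular set `{|cos 2θ| < η}` -/

/-- If `|ψ| ≤ π/4` and `|sin 2ψ| < η` then `|ψ| < πη/4` (Jordan's inequality). [folklore] -/
theorem abs_lt_of_abs_sin_two_mul_lt {ψ η : ℝ} (hψ : |ψ| ≤ π / 4) (h : |Real.sin (2 * ψ)| < η) :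
    |ψ| < π * η / 4 := by
  obtain ⟨hπ0, hπ⟩ : (0 : ℝ) < π ∧ (2 : ℝ) ≤ π := ⟨Real.pi_pos, Real.two_le_pi⟩
  have h2 : |2 * ψ| = 2 * |ψ| := by rw [abs_mul, abs_two]
  have hle : |2 * ψ| ≤ π := by rw [h2]; linarith
  have hJ := Real.mul_le_sin (abs_nonneg (2 * ψ)) (by rw [h2]; linarith)
  have habs : Real.sin |2 * ψ| = |Real.sin (2 * ψ)| := by
    have h0 : 0 ≤ Real.sin |2 * ψ| := Real.sin_nonneg_of_nonneg_of_le_pi (abs_nonneg _) hle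
    rcases le_total 0 (2 * ψ) with hx0 | hx0
    · rw [abs_of_nonneg hx0] at h0 ⊢
      exact (abs_of_nonneg h0).symm
    · rw [abs_of_nonpos hx0] at h0 ⊢
      rw [Real.sin_neg] at h0 ⊢
      exact (abs_of_nonpos (by linarith)).symm
  rw [habs, h2] at hJ
  -- `2/π · 2|ψ| ≤ |sin 2ψ| < η`
  have h3 : 2 / π * (2 * |ψ|) < η := hJ.trans_lt h
  rw [div_mul_eq_mul_div, div_lt_iff₀ (by linarith : (0 : ℝ) < π)] at h3
  rw [lt_div_iff₀ (by norm_num : (0 : ℝ) < 4)]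
  linarith

/-- **Angular localisation.** A direction `θ ∈ (-π, π)` with `|cos 2θ| < η` lies within `πη/4` of one of
the four diagonal directions `π/4, -π/4, 3π/4, -3π/4`. [folklore] -/
theorem abs_lt_of_abs_cos_two_mul_lt {θ η : ℝ} (hθ : θ ∈ Ioo (-π) π) (h : |Real.cos (2 * θ)| < η) :
    |θ - π / 4| < π * η / 4 ∨ |θ + π / 4| < π * η / 4 ∨
      |θ - 3 * π / 4| < π * η / 4 ∨ |θ + 3 * π / 4| < π * η / 4 := by
  obtain ⟨hπ0, hπ⟩ : (0 : ℝ) < π ∧ (2 : ℝ) ≤ π := ⟨Real.pi_pos, Real.two_le_pi⟩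
  rcases le_or_gt 0 θ with h0 | h0
  · rcases le_or_gt θ (π / 2) with h1 | h1
    · -- first quadrant: `ψ = θ - π/4`, `cos 2θ = -sin 2ψ`
      refine Or.inl (abs_lt_of_abs_sin_two_mul_lt (abs_le.2 ⟨by linarith, by linarith⟩) ?_)
      have e : Real.cos (2 * θ) = -Real.sin (2 * (θ - π / 4)) := by
        rw [← Real.cos_add_pi_div_two]; congr 1; ring
      rwa [e, abs_neg] at h
    · -- second quadrant: `ψ = θ - 3π/4`, `cos 2θ = sin 2ψ`
      refine Or.inr (Or.inr (Or.inl (abs_lt_of_abs_sin_two_mul_lt (abs_le.2 ⟨by linarith, by linarith [hθ.2]⟩) ?_)))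
      have e : Real.cos (2 * θ) = Real.sin (2 * (θ - 3 * π / 4)) := by
        rw [show 2 * (θ - 3 * π / 4) = (2 * θ + π / 2) - 2 * π by ring, Real.sin_sub_two_pi,
          Real.sin_add_pi_div_two]
      rwa [e] at h
  · rcases le_or_gt (-(π / 2)) θ with h1 | h1
    · -- fourth quadrant: `ψ = θ + π/4`, `cos 2θ = sin 2ψ`
      refine Or.inr (Or.inl (abs_lt_of_abs_sin_two_mul_lt (abs_le.2 ⟨by linarith, by linarith⟩) ?_))
      have e : Real.cos (2 * θ) = Real.sin (2 * (θ + π / 4)) := by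
        rw [← Real.cos_sub_pi_div_two]; congr 1; ring
      rwa [e] at h
    · -- third quadrant: `ψ = θ + 3π/4`, `cos 2θ = -sin 2ψ`
      refine Or.inr (Or.inr (Or.inr (abs_lt_of_abs_sin_two_mul_lt (abs_le.2 ⟨by linarith [hθ.1], by linarith⟩) ?_)))
      have e : Real.cos (2 * θ) = -Real.sin (2 * (θ + 3 * π / 4)) := by
        rw [show 2 * (θ + 3 * π / 4) = (2 * θ - π / 2) + 2 * π by ring, Real.sin_add_two_pi,
          Real.sin_sub_pi_div_two, neg_neg]
      rwa [e, abs_neg] at h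

/-- **The angular set has measure `≤ 2πη`**: `vol {θ ∈ (-π, π) : |cos 2θ| < η} ≤ 2πη`. [folklore] -/
theorem volume_abs_cos_two_mul_lt_le {η : ℝ} (hη : 0 ≤ η) :
    volume {θ : ℝ | θ ∈ Ioo (-π) π ∧ |Real.cos (2 * θ)| < η} ≤ ENNReal.ofReal (2 * π * η) := by
  obtain ⟨hπ0, hπ⟩ : (0 : ℝ) < π ∧ (2 : ℝ) ≤ π := ⟨Real.pi_pos, Real.two_le_pi⟩
  set w : ℝ := π * η / 4 with hw
  have hw0 : 0 ≤ w := by positivity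
  have hsub : {θ : ℝ | θ ∈ Ioo (-π) π ∧ |Real.cos (2 * θ)| < η} ⊆
      ((Ioo (π / 4 - w) (π / 4 + w) ∪ Ioo (-(π / 4) - w) (-(π / 4) + w)) ∪
        Ioo (3 * π / 4 - w) (3 * π / 4 + w)) ∪ Ioo (-(3 * π / 4) - w) (-(3 * π / 4) + w) := by
    rintro θ ⟨hθ, h⟩
    rcases abs_lt_of_abs_cos_two_mul_lt hθ h with h1 | h1 | h1 | h1
    · refine Or.inl (Or.inl (Or.inl ?_))
      rw [abs_lt] at h1; constructor <;> linarith [h1.1, h1.2]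
    · refine Or.inl (Or.inl (Or.inr ?_))
      rw [abs_lt] at h1; constructor <;> linarith [h1.1, h1.2]
    · refine Or.inl (Or.inr ?_)
      rw [abs_lt] at h1; constructor <;> linarith [h1.1, h1.2]
    · refine Or.inr ?_
      rw [abs_lt] at h1; constructor <;> linarith [h1.1, h1.2]
  have hI : ∀ c : ℝ, volume (Ioo (c - w) (c + w)) = ENNReal.ofReal (2 * w) := fun c => by
    rw [Real.volume_Ioo]; congr 1; ring
  calc volume {θ : ℝ | θ ∈ Ioo (-π) π ∧ |Real.cos (2 * θ)| < η}
      ≤ volume (((Ioo (π / 4 - w) (π / 4 + w) ∪ Ioo (-(π / 4) - w) (-(π / 4) + w)) ∪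
          Ioo (3 * π / 4 - w) (3 * π / 4 + w)) ∪ Ioo (-(3 * π / 4) - w) (-(3 * π / 4) + w)) :=
        measure_mono hsub
    _ ≤ volume (Ioo (π / 4 - w) (π / 4 + w)) + volume (Ioo (-(π / 4) - w) (-(π / 4) + w)) +
          volume (Ioo (3 * π / 4 - w) (3 * π / 4 + w)) + volume (Ioo (-(3 * π / 4) - w) (-(3 * π / 4) + w)) := by
        refine (measure_union_le _ _).trans ?_
        gcongr
        refine (measure_union_le _ _).trans ?_
        gcongr
        exact measure_union_le _ _
    _ = ENNReal.ofReal (2 * π * η) := by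
        rw [hI, hI, hI, hI, ← ENNReal.ofReal_add (by positivity) (by positivity),
          ← ENNReal.ofReal_add (by positivity) (by positivity),
          ← ENNReal.ofReal_add (by positivity) (by positivity)]
        congr 1
        rw [hw]; ring

/-! ### The nodal set in the plane -/

/-- The nodal set written in the coordinates `(k₀, k₁) ∈ ℝ × ℝ`. [folklore] -/
theorem nodalShell_eq_preimage (μ Δ t : ℝ) :
    brillouinZone ∩ {p : Momentum | (squareDispersion 1 0 p - μ) ^ 2 +
        (Δ * (Real.cos (p 0) - Real.cos (p 1))) ^ 2 < t ^ 2} =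
      (fun k : Momentum => ((k 0, k 1) : ℝ × ℝ)) ⁻¹'
        {x : ℝ × ℝ | (x.1 ∈ Ico (-π) π ∧ x.2 ∈ Ico (-π) π) ∧
          (-2 * (Real.cos x.1 + Real.cos x.2) - μ) ^ 2 + (Δ * (Real.cos x.1 - Real.cos x.2)) ^ 2 < t ^ 2} := by
  ext k
  have e : squareDispersion 1 0 k = -2 * (Real.cos (k 0) + Real.cos (k 1)) := by
    unfold squareDispersion; ring
  simp only [brillouinZone, mem_inter_iff, mem_setOf_eq, mem_preimage, Fin.forall_fin_two, e]

/-- The planar nodal set is measurable. [folklore] -/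
theorem measurableSet_planarNodalShell (μ Δ t : ℝ) :
    MeasurableSet {x : ℝ × ℝ | (x.1 ∈ Ico (-π) π ∧ x.2 ∈ Ico (-π) π) ∧
      (-2 * (Real.cos x.1 + Real.cos x.2) - μ) ^ 2 + (Δ * (Real.cos x.1 - Real.cos x.2)) ^ 2 < t ^ 2} := by
  have h1 : MeasurableSet {x : ℝ × ℝ | x.1 ∈ Ico (-π) π ∧ x.2 ∈ Ico (-π) π} := by
    have : {x : ℝ × ℝ | x.1 ∈ Ico (-π) π ∧ x.2 ∈ Ico (-π) π} = Ico (-π) π ×ˢ Ico (-π) π := by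
      ext x; simp [mem_prod]
    rw [this]
    exact measurableSet_Ico.prod measurableSet_Ico
  have hc : Continuous fun x : ℝ × ℝ =>
      (-2 * (Real.cos x.1 + Real.cos x.2) - μ) ^ 2 + (Δ * (Real.cos x.1 - Real.cos x.2)) ^ 2 := by fun_prop
  exact h1.inter (measurableSet_lt hc.measurable measurable_const)

/-! ### The nodal shell-volume estimate -/

/-- **The nodal shell-volume estimate for the `d`-wave BdG band.** For a compact sub-band
`[μ₁, μ₂] ⊂ (-4, 0)` and a cap `Δ₀ > 0` on the gap amplitude there is `C ≥ 0` with
`vol(BZ ∩ {(ε - μ)² + Δ²(cos k₁ - cos k₂)² < t²}) ≤ C · t²/Δ`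
for all `μ ∈ [μ₁, μ₂]`, `0 < Δ ≤ Δ₀` and `t > 0`: the phase space below energy `t` of the nodal
quasi-particle band `E = √((ε-μ)² + Δ²d²)` is quadratic in `t` (linear density of states) and
inversely proportional to the gap. [folklore] -/
theorem exists_nodalShellVolume_le {μ₁ μ₂ Δ₀ : ℝ} (hμ₁ : -4 < μ₁) (hμ₂ : μ₂ < 0) (hΔ₀ : 0 < Δ₀) :
    ∃ C : ℝ, 0 ≤ C ∧ ∀ μ ∈ Icc μ₁ μ₂, ∀ Δ ∈ Ioc (0 : ℝ) Δ₀, ∀ t : ℝ, 0 < t →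
      volume (brillouinZone ∩ {p : Momentum | (squareDispersion 1 0 p - μ) ^ 2 +
        (Δ * (Real.cos (p 0) - Real.cos (p 1))) ^ 2 < t ^ 2}) ≤ ENNReal.ofReal (C * t ^ 2 / Δ) := by
  obtain ⟨hπ0, hπ⟩ : (0 : ℝ) < π ∧ (2 : ℝ) ≤ π := ⟨Real.pi_pos, Real.two_le_pi⟩
  rcases lt_or_ge μ₂ μ₁ with h21 | h12
  · exact ⟨0, le_rfl, fun μ hμ => absurd (hμ.1.trans hμ.2) (not_le.2 h21)⟩
  -- widened band `[a, b]` and the width threshold `t₀`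
  set t₀ : ℝ := min (μ₁ + 4) (-μ₂) / 2 with ht₀
  have ht₀pos : 0 < t₀ := by
    rw [ht₀]; exact half_pos (lt_min (by linarith) (by linarith))
  have ht₀1 : t₀ ≤ (μ₁ + 4) / 2 := by
    rw [ht₀]; exact div_le_div_of_nonneg_right (min_le_left _ _) two_pos.le
  have ht₀2 : t₀ ≤ -μ₂ / 2 := by
    rw [ht₀]; exact div_le_div_of_nonneg_right (min_le_right _ _) two_pos.le
  set a : ℝ := μ₁ - t₀ with ha
  set b : ℝ := μ₂ + t₀ with hb
  have ha4 : -4 < a := by rw [ha]; linarith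
  have hb0 : b < 0 := by rw [hb]; linarith
  obtain ⟨L, hL0, hL⟩ := exists_bandFermiRadius_sub_le ha4 hb0
  obtain ⟨κ, hκ0, hκ⟩ := exists_mul_abs_cos_two_mul_le_abs_dWave ha4 hb0
  set V : ℝ := (volume brillouinZone).toReal with hV
  have hV0 : 0 ≤ V := ENNReal.toReal_nonneg
  refine ⟨max (32 * π * L / κ) (V * Δ₀ / t₀ ^ 2), le_max_of_le_left (by positivity),
    fun μ hμ Δ hΔ t ht => ?_⟩
  have hΔ0 : 0 < Δ := hΔ.1
  set C : ℝ := max (32 * π * L / κ) (V * Δ₀ / t₀ ^ 2) with hC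
  rcases le_or_gt t₀ t with hlarge | hsmall
  · -- large widths: the whole zone
    calc volume (brillouinZone ∩ {p : Momentum | (squareDispersion 1 0 p - μ) ^ 2 +
          (Δ * (Real.cos (p 0) - Real.cos (p 1))) ^ 2 < t ^ 2})
        ≤ volume brillouinZone := measure_mono inter_subset_left
      _ = ENNReal.ofReal V := by rw [hV, ENNReal.ofReal_toReal volume_brillouinZone_lt_top.ne]
      _ ≤ ENNReal.ofReal (C * t ^ 2 / Δ) := by
          refine ENNReal.ofReal_le_ofReal ?_
          rw [le_div_iff₀ hΔ0]
          have h1 : V * Δ ≤ V * Δ₀ := mul_le_mul_of_nonneg_left hΔ.2 hV0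
          have h2 : V * Δ₀ = V * Δ₀ / t₀ ^ 2 * t₀ ^ 2 := by field_simp
          have h3 : V * Δ₀ / t₀ ^ 2 * t₀ ^ 2 ≤ C * t₀ ^ 2 := by
            gcongr; exact le_max_right _ _
          have h4 : C * t₀ ^ 2 ≤ C * t ^ 2 := by
            have hC0 : 0 ≤ C := le_max_of_le_left (by positivity)
            gcongr
          linarith
  -- small widths: polar coordinates
  have hμt1 : μ - t ∈ Icc a b := ⟨by rw [ha]; linarith [hμ.1], by rw [hb]; linarith [hμ.2]⟩
  have hμt2 : μ + t ∈ Icc a b := ⟨by rw [ha]; linarith [hμ.1], by rw [hb]; linarith [hμ.2]⟩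
  have hband : ∀ ν ∈ Icc a b, -4 < ν ∧ ν < 0 := fun ν hν => ⟨ha4.trans_le hν.1, hν.2.trans_lt hb0⟩
  set E' : Set (ℝ × ℝ) := {x : ℝ × ℝ | (x.1 ∈ Ico (-π) π ∧ x.2 ∈ Ico (-π) π) ∧
    (-2 * (Real.cos x.1 + Real.cos x.2) - μ) ^ 2 + (Δ * (Real.cos x.1 - Real.cos x.2)) ^ 2 < t ^ 2} with hE'
  have hE'm : MeasurableSet E' := measurableSet_planarNodalShell μ Δ t
  -- transfer to the plane
  have hvolE : volume (brillouinZone ∩ {p : Momentum | (squareDispersion 1 0 p - μ) ^ 2 +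
      (Δ * (Real.cos (p 0) - Real.cos (p 1))) ^ 2 < t ^ 2}) = volume E' := by
    rw [nodalShell_eq_preimage, measurePreserving_momentum_prod.measure_preimage hE'm.nullMeasurableSet]
  rw [hvolE]
  -- the radial window and the angular set
  set η : ℝ := t / (Δ * κ) with hη
  have hη0 : 0 ≤ η := by positivity
  set R₁ : ℝ → ℝ := fun θ => bandFermiRadius (μ - t) θ with hR₁
  set R₂ : ℝ → ℝ := fun θ => bandFermiRadius (μ + t) θ with hR₂
  have hR₁c : Continuous R₁ := continuous_bandFermiRadius (hband _ hμt1).1 (hband _ hμt1).2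
  have hR₂c : Continuous R₂ := continuous_bandFermiRadius (hband _ hμt2).1 (hband _ hμt2).2
  set W : Set (ℝ × ℝ) := {q : ℝ × ℝ | (R₁ q.2 < q.1 ∧ q.1 < R₂ q.2) ∧ |Real.cos (2 * q.2)| < η} with hW
  set g : ℝ × ℝ → ℝ≥0∞ := fun q => ENNReal.ofReal 8 * W.indicator (fun _ => (1 : ℝ≥0∞)) q with hg
  have hWm : MeasurableSet W := by
    refine ((measurableSet_lt (hR₁c.measurable.comp measurable_snd) measurable_fst).inter
      (measurableSet_lt measurable_fst (hR₂c.measurable.comp measurable_snd))).inter ?_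
    have hc : Measurable fun q : ℝ × ℝ => |Real.cos (2 * q.2)| := by fun_prop
    exact measurableSet_lt hc measurable_const
  have hgm : Measurable g := (measurable_const.indicator hWm).const_mul _
  -- polar coordinates and the pointwise bound on the target
  have hpolar : volume E' = ∫⁻ q in polarCoord.target,
      ENNReal.ofReal q.1 • E'.indicator (1 : ℝ × ℝ → ℝ≥0∞) (polarCoord.symm q) := by
    rw [lintegral_comp_polarCoord_symm (E'.indicator 1), lintegral_indicator_one hE'm]
  have hpt : ∀ q ∈ polarCoord.target,
      ENNReal.ofReal q.1 • E'.indicator (1 : ℝ × ℝ → ℝ≥0∞) (polarCoord.symm q) ≤ g q := by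
    rintro ⟨r, θ⟩ hq
    simp only [polarCoord_target, mem_prod, mem_Ioi, mem_Ioo] at hq
    by_cases hmem : polarCoord.symm (r, θ) ∈ E'
    · rw [indicator_of_mem hmem, Pi.one_apply, smul_eq_mul, mul_one]
      simp only [polarCoord_symm_apply] at hmem
      obtain ⟨⟨hx, hy⟩, hε⟩ := hmem
      have hx' : |r * Real.cos θ| ≤ π := abs_le.2 ⟨hx.1, hx.2.le⟩
      have hy' : |r * Real.sin θ| ≤ π := abs_le.2 ⟨hy.1, hy.2.le⟩
      -- the two consequences of `ξ² + Δ²d² < t²`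
      have hξ : |-2 * (Real.cos (r * Real.cos θ) + Real.cos (r * Real.sin θ)) - μ| < t :=
        abs_lt_of_sq_lt_sq (by nlinarith [sq_nonneg (Δ * (Real.cos (r * Real.cos θ) - Real.cos (r * Real.sin θ)))]) ht.le
      have hdd : |Δ * (Real.cos (r * Real.cos θ) - Real.cos (r * Real.sin θ))| < t :=
        abs_lt_of_sq_lt_sq (by nlinarith [sq_nonneg (-2 * (Real.cos (r * Real.cos θ) + Real.cos (r * Real.sin θ)) - μ)]) ht.le
      rw [abs_mul, abs_of_pos hΔ0] at hdd
      have hray : rayDispersion (θ, r) = -2 * (Real.cos (r * Real.cos θ) + Real.cos (r * Real.sin θ)) :=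
        rayDispersion_eq (θ, r)
      have hlo : μ - t < rayDispersion (θ, r) := by rw [hray]; linarith [(abs_lt.1 hξ).1]
      have hhi : rayDispersion (θ, r) < μ + t := by rw [hray]; linarith [(abs_lt.1 hξ).2]
      have hwin := bandFermiRadius_lt_of_polar_mem (hband _ hμt1).1 (hband _ hμt1).2 (hband _ hμt2).1
        (hband _ hμt2).2 hq.1 hx' hy' hlo hhi
      -- the angular localisation
      have hκθ := hκ r θ hq.1.le hx' hy' (by rw [← hray]; linarith [hμt1.1])
        (by rw [← hray]; linarith [hμt2.2])
      have hang : |Real.cos (2 * θ)| < η := by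
        rw [hη, lt_div_iff₀ (mul_pos hΔ0 hκ0)]
        calc |Real.cos (2 * θ)| * (Δ * κ) = Δ * (κ * |Real.cos (2 * θ)|) := by ring
          _ ≤ Δ * |Real.cos (r * Real.cos θ) - Real.cos (r * Real.sin θ)| :=
              mul_le_mul_of_nonneg_left hκθ hΔ0.le
          _ < t := hdd
      have hr8 : r ≤ 8 := (polar_mem_square_bounds hq.1 hx' hy').2
      rw [hg]
      simp only
      rw [indicator_of_mem (show ((r, θ) : ℝ × ℝ) ∈ W from ⟨hwin, hang⟩), mul_one]
      exact ENNReal.ofReal_le_ofReal hr8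
    · rw [indicator_of_notMem hmem, smul_zero]
      exact bot_le
  -- integrate the bound
  set T : Set ℝ := {θ : ℝ | |Real.cos (2 * θ)| < η} with hT
  have hTm : MeasurableSet T := by
    have hc : Measurable fun θ : ℝ => |Real.cos (2 * θ)| := by fun_prop
    exact measurableSet_lt hc measurable_const
  have hI : ∫⁻ q in polarCoord.target, g q ≤ ENNReal.ofReal (32 * π * L / κ * t ^ 2 / Δ) := by
    rw [polarCoord_target, show (volume : Measure (ℝ × ℝ)) = (volume : Measure ℝ).prod volume from rfl,
      ← Measure.prod_restrict, lintegral_prod_symm _ hgm.aemeasurable]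
    -- inner integral in `r`
    have hinner : ∀ θ ∈ Ioo (-π) π, ∫⁻ r in Ioi (0 : ℝ), g (r, θ) ≤
        ENNReal.ofReal (8 * (L * (2 * t))) * T.indicator 1 θ := by
      intro θ hθ
      have hθ' : θ ∈ Icc (-π) π := Ioo_subset_Icc_self hθ
      by_cases hθT : θ ∈ T
      · rw [indicator_of_mem hθT, Pi.one_apply, mul_one]
        have hdiff : R₂ θ - R₁ θ ≤ L * (2 * t) := by
          have h := hL θ hθ' (μ - t) hμt1 (μ + t) hμt2 (by linarith)
          rw [show μ + t - (μ - t) = 2 * t by ring] at h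
          exact h
        have hgr : ∀ r, g (r, θ) = ENNReal.ofReal 8 * (Ioo (R₁ θ) (R₂ θ)).indicator 1 r := fun r => by
          have hθT' : |Real.cos (2 * θ)| < η := hθT
          simp only [hg, hW, indicator, mem_setOf_eq, mem_Ioo, Pi.one_apply, hθT', and_true]
        calc ∫⁻ r in Ioi (0 : ℝ), g (r, θ)
            ≤ ∫⁻ r, g (r, θ) := lintegral_mono' Measure.restrict_le_self le_rfl
          _ = ENNReal.ofReal 8 * volume (Ioo (R₁ θ) (R₂ θ)) := by
              simp_rw [hgr]
              rw [lintegral_const_mul' _ _ ENNReal.ofReal_ne_top, lintegral_indicator_one measurableSet_Ioo]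
          _ = ENNReal.ofReal 8 * ENNReal.ofReal (R₂ θ - R₁ θ) := by rw [Real.volume_Ioo]
          _ ≤ ENNReal.ofReal 8 * ENNReal.ofReal (L * (2 * t)) := by gcongr
          _ = ENNReal.ofReal (8 * (L * (2 * t))) := (ENNReal.ofReal_mul (by norm_num)).symm
      · rw [indicator_of_notMem hθT, mul_zero]
        have hgr : ∀ r, g (r, θ) = 0 := fun r => by
          have hθT' : ¬ |Real.cos (2 * θ)| < η := hθT
          simp only [hg, hW, indicator, mem_setOf_eq, hθT', and_false, if_false, mul_zero]
        simp_rw [hgr]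
        rw [lintegral_zero]
    calc ∫⁻ θ in Ioo (-π) π, ∫⁻ r in Ioi (0 : ℝ), g (r, θ)
        ≤ ∫⁻ θ in Ioo (-π) π, ENNReal.ofReal (8 * (L * (2 * t))) * T.indicator 1 θ :=
          setLIntegral_mono (measurable_const.mul (measurable_const.indicator hTm)) hinner
      _ = ENNReal.ofReal (8 * (L * (2 * t))) * volume {θ : ℝ | θ ∈ Ioo (-π) π ∧ |Real.cos (2 * θ)| < η} := by
          rw [lintegral_const_mul' _ _ ENNReal.ofReal_ne_top, lintegral_indicator_one hTm,
            Measure.restrict_apply hTm]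
          congr 2
          ext θ
          simp only [hT, mem_inter_iff, mem_setOf_eq]
          tauto
      _ ≤ ENNReal.ofReal (8 * (L * (2 * t))) * ENNReal.ofReal (2 * π * η) := by
          gcongr
          exact volume_abs_cos_two_mul_lt_le hη0
      _ = ENNReal.ofReal (32 * π * L / κ * t ^ 2 / Δ) := by
          rw [← ENNReal.ofReal_mul (by positivity)]
          congr 1
          rw [hη]
          field_simp
          ring
  calc volume E' = ∫⁻ q in polarCoord.target,
        ENNReal.ofReal q.1 • E'.indicator (1 : ℝ × ℝ → ℝ≥0∞) (polarCoord.symm q) := hpolar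
    _ ≤ ∫⁻ q in polarCoord.target, g q := setLIntegral_mono hgm hpt
    _ ≤ ENNReal.ofReal (32 * π * L / κ * t ^ 2 / Δ) := hI
    _ ≤ ENNReal.ofReal (C * t ^ 2 / Δ) := by
        refine ENNReal.ofReal_le_ofReal ?_
        have h1 : 32 * π * L / κ ≤ C := le_max_left _ _
        have h2 : 0 ≤ t ^ 2 / Δ := by positivity
        calc 32 * π * L / κ * t ^ 2 / Δ = 32 * π * L / κ * (t ^ 2 / Δ) := by ring
          _ ≤ C * (t ^ 2 / Δ) := mul_le_mul_of_nonneg_right h1 h2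
          _ = C * t ^ 2 / Δ := by ring

/-! ### Planar versions: the squares `[-π, π)²` and `[0, 2π)²`, and the pair-source normalisation -/

/-- **The nodal shell-volume estimate in planar coordinates** (`(k₀, k₁) ∈ [-π, π)² ⊂ ℝ × ℝ`): same
constant as `exists_nodalShellVolume_le`. [folklore] -/
theorem exists_planarNodalShellVolume_le {μ₁ μ₂ Δ₀ : ℝ} (hμ₁ : -4 < μ₁) (hμ₂ : μ₂ < 0) (hΔ₀ : 0 < Δ₀) :
    ∃ C : ℝ, 0 ≤ C ∧ ∀ μ ∈ Icc μ₁ μ₂, ∀ Δ ∈ Ioc (0 : ℝ) Δ₀, ∀ t : ℝ, 0 < t →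
      volume {x : ℝ × ℝ | (x.1 ∈ Ico (-π) π ∧ x.2 ∈ Ico (-π) π) ∧
        (-2 * (Real.cos x.1 + Real.cos x.2) - μ) ^ 2 + (Δ * (Real.cos x.1 - Real.cos x.2)) ^ 2 < t ^ 2}
        ≤ ENNReal.ofReal (C * t ^ 2 / Δ) := by
  obtain ⟨C, hC0, hC⟩ := exists_nodalShellVolume_le hμ₁ hμ₂ hΔ₀
  refine ⟨C, hC0, fun μ hμ Δ hΔ t ht => ?_⟩
  have h := hC μ hμ Δ hΔ t ht
  rwa [nodalShell_eq_preimage, measurePreserving_momentum_prod.measure_preimage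
    (measurableSet_planarNodalShell μ Δ t).nullMeasurableSet] at h

/-- **The nodal shell-volume estimate on the period square `[0, 2π)²`** (the convention of the
Brillouin-zone averages `(4π²)⁻¹ ∫₀^{2π}∫₀^{2π}` of the tree's free BdG formulas): by `2π`-periodicity
the set is covered by four translates of the `[-π, π)²` set, so the constant is multiplied by `4`.
[folklore] -/
theorem exists_planarNodalShellVolume_le_twoPi {μ₁ μ₂ Δ₀ : ℝ} (hμ₁ : -4 < μ₁) (hμ₂ : μ₂ < 0)
    (hΔ₀ : 0 < Δ₀) :
    ∃ C : ℝ, 0 ≤ C ∧ ∀ μ ∈ Icc μ₁ μ₂, ∀ Δ ∈ Ioc (0 : ℝ) Δ₀, ∀ t : ℝ, 0 < t →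
      volume {x : ℝ × ℝ | (x.1 ∈ Ico 0 (2 * π) ∧ x.2 ∈ Ico 0 (2 * π)) ∧
        (-2 * (Real.cos x.1 + Real.cos x.2) - μ) ^ 2 + (Δ * (Real.cos x.1 - Real.cos x.2)) ^ 2 < t ^ 2}
        ≤ ENNReal.ofReal (C * t ^ 2 / Δ) := by
  have hπ0 : 0 < π := Real.pi_pos
  obtain ⟨C, hC0, hC⟩ := exists_planarNodalShellVolume_le hμ₁ hμ₂ hΔ₀
  refine ⟨4 * C, by positivity, fun μ hμ Δ hΔ t ht => ?_⟩
  set F : ℝ × ℝ → ℝ := fun x =>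
    (-2 * (Real.cos x.1 + Real.cos x.2) - μ) ^ 2 + (Δ * (Real.cos x.1 - Real.cos x.2)) ^ 2 with hF
  set S₁ : Set (ℝ × ℝ) := {x : ℝ × ℝ | (x.1 ∈ Ico (-π) π ∧ x.2 ∈ Ico (-π) π) ∧ F x < t ^ 2} with hS₁
  have hS₁ := hC μ hμ Δ hΔ t ht
  -- periodicity of the defining function
  have hF1 : ∀ x : ℝ × ℝ, F (x + ((-(2 * π), 0) : ℝ × ℝ)) = F x := fun x => by
    simp only [hF, Prod.fst_add, Prod.snd_add, add_zero, ← sub_eq_add_neg, Real.cos_sub_two_pi]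
  have hF2 : ∀ x : ℝ × ℝ, F (x + ((0, -(2 * π)) : ℝ × ℝ)) = F x := fun x => by
    simp only [hF, Prod.fst_add, Prod.snd_add, add_zero, ← sub_eq_add_neg, Real.cos_sub_two_pi]
  have hF3 : ∀ x : ℝ × ℝ, F (x + ((-(2 * π), -(2 * π)) : ℝ × ℝ)) = F x := fun x => by
    simp only [hF, Prod.fst_add, Prod.snd_add, ← sub_eq_add_neg, Real.cos_sub_two_pi]
  -- the four translates cover the `[0, 2π)²` set
  have hsub : {x : ℝ × ℝ | (x.1 ∈ Ico 0 (2 * π) ∧ x.2 ∈ Ico 0 (2 * π)) ∧ F x < t ^ 2} ⊆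
      ((S₁ ∪ (fun z : ℝ × ℝ => z + ((-(2 * π), 0) : ℝ × ℝ)) ⁻¹' S₁) ∪
        (fun z : ℝ × ℝ => z + ((0, -(2 * π)) : ℝ × ℝ)) ⁻¹' S₁) ∪
        (fun z : ℝ × ℝ => z + ((-(2 * π), -(2 * π)) : ℝ × ℝ)) ⁻¹' S₁ := by
    rintro ⟨x, y⟩ ⟨⟨hx, hy⟩, hFx⟩
    rcases lt_or_ge x π with hxπ | hxπ <;> rcases lt_or_ge y π with hyπ | hyπ
    · exact Or.inl (Or.inl (Or.inl ⟨⟨⟨by linarith [hx.1], hxπ⟩, ⟨by linarith [hy.1], hyπ⟩⟩, hFx⟩))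
    · refine Or.inl (Or.inr ?_)
      refine ⟨⟨?_, ?_⟩, by rw [hF2]; exact hFx⟩
      · simpa using ⟨by linarith [hx.1], hxπ⟩
      · simp only [Prod.snd_add, mem_Ico]; constructor <;> linarith [hy.2]
    · refine Or.inl (Or.inl (Or.inr ?_))
      refine ⟨⟨?_, ?_⟩, by rw [hF1]; exact hFx⟩
      · simp only [Prod.fst_add, mem_Ico]; constructor <;> linarith [hx.2]
      · simpa using ⟨by linarith [hy.1], hyπ⟩
    · refine Or.inr ?_
      refine ⟨⟨?_, ?_⟩, by rw [hF3]; exact hFx⟩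
      · simp only [Prod.fst_add, mem_Ico]; constructor <;> linarith [hx.2]
      · simp only [Prod.snd_add, mem_Ico]; constructor <;> linarith [hy.2]
  have htr : ∀ v : ℝ × ℝ, volume ((fun z : ℝ × ℝ => z + v) ⁻¹' S₁) = volume S₁ := fun v =>
    measure_preimage_add_right _ v S₁
  calc volume {x : ℝ × ℝ | (x.1 ∈ Ico 0 (2 * π) ∧ x.2 ∈ Ico 0 (2 * π)) ∧ F x < t ^ 2}
      ≤ volume (((S₁ ∪ (fun z : ℝ × ℝ => z + ((-(2 * π), 0) : ℝ × ℝ)) ⁻¹' S₁) ∪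
          (fun z : ℝ × ℝ => z + ((0, -(2 * π)) : ℝ × ℝ)) ⁻¹' S₁) ∪
          (fun z : ℝ × ℝ => z + ((-(2 * π), -(2 * π)) : ℝ × ℝ)) ⁻¹' S₁) := measure_mono hsub
    _ ≤ volume S₁ + volume ((fun z : ℝ × ℝ => z + ((-(2 * π), 0) : ℝ × ℝ)) ⁻¹' S₁) +
          volume ((fun z : ℝ × ℝ => z + ((0, -(2 * π)) : ℝ × ℝ)) ⁻¹' S₁) +
          volume ((fun z : ℝ × ℝ => z + ((-(2 * π), -(2 * π)) : ℝ × ℝ)) ⁻¹' S₁) := by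
        refine (measure_union_le _ _).trans ?_
        gcongr
        refine (measure_union_le _ _).trans ?_
        gcongr
        exact measure_union_le _ _
    _ = 4 * volume S₁ := by rw [htr, htr, htr]; ring
    _ ≤ 4 * ENNReal.ofReal (C * t ^ 2 / Δ) := by gcongr
    _ = ENNReal.ofReal (4 * C * t ^ 2 / Δ) := by
        rw [show (4 : ℝ≥0∞) = ENNReal.ofReal 4 by norm_num, ← ENNReal.ofReal_mul (by norm_num)]
        congr 1; ring

/-- **The nodal shell-volume estimate in the normalisation of the `d`-wave pair source** of the tree
(`dWaveSourceTorus`, free BdG band `E = √(ξ² + (2√2 h (cos k₁ - cos k₂))²)`, `ξ = -2(cos k₁ + cos k₂) - μ`,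
cf. `DWaveSourceFreePressure`): on the period square `[0, 2π)²`, for `[μ₁, μ₂] ⊂ (-4, 0)` and `h₀ > 0`,
`vol {ξ² + 8h²d² < t²} ≤ C t²/|h|` for all `μ ∈ [μ₁, μ₂]`, `0 < |h| ≤ h₀`, `t > 0`. [folklore] -/
theorem exists_planarNodalShellVolume_le_dWaveSource {μ₁ μ₂ h₀ : ℝ} (hμ₁ : -4 < μ₁) (hμ₂ : μ₂ < 0)
    (hh₀ : 0 < h₀) :
    ∃ C : ℝ, 0 ≤ C ∧ ∀ μ ∈ Icc μ₁ μ₂, ∀ h : ℝ, h ≠ 0 → |h| ≤ h₀ → ∀ t : ℝ, 0 < t →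
      volume {x : ℝ × ℝ | (x.1 ∈ Ico 0 (2 * π) ∧ x.2 ∈ Ico 0 (2 * π)) ∧
        (-2 * (Real.cos x.1 + Real.cos x.2) - μ) ^ 2 +
          (2 * Real.sqrt 2 * h * (Real.cos x.1 - Real.cos x.2)) ^ 2 < t ^ 2}
        ≤ ENNReal.ofReal (C * t ^ 2 / |h|) := by
  have hs2 : 0 < 2 * Real.sqrt 2 := by positivity
  obtain ⟨C, hC0, hC⟩ := exists_planarNodalShellVolume_le_twoPi hμ₁ hμ₂ (mul_pos hs2 hh₀)
  refine ⟨C / (2 * Real.sqrt 2), by positivity, fun μ hμ h hh hhh t ht => ?_⟩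
  have hha : 0 < |h| := abs_pos.2 hh
  have hΔ : 2 * Real.sqrt 2 * |h| ∈ Ioc (0 : ℝ) (2 * Real.sqrt 2 * h₀) :=
    ⟨mul_pos hs2 hha, mul_le_mul_of_nonneg_left hhh hs2.le⟩
  have hset : {x : ℝ × ℝ | (x.1 ∈ Ico 0 (2 * π) ∧ x.2 ∈ Ico 0 (2 * π)) ∧
      (-2 * (Real.cos x.1 + Real.cos x.2) - μ) ^ 2 +
        (2 * Real.sqrt 2 * h * (Real.cos x.1 - Real.cos x.2)) ^ 2 < t ^ 2} =
      {x : ℝ × ℝ | (x.1 ∈ Ico 0 (2 * π) ∧ x.2 ∈ Ico 0 (2 * π)) ∧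
      (-2 * (Real.cos x.1 + Real.cos x.2) - μ) ^ 2 +
        (2 * Real.sqrt 2 * |h| * (Real.cos x.1 - Real.cos x.2)) ^ 2 < t ^ 2} := by
    ext x
    simp only [mem_setOf_eq]
    rw [show (2 * Real.sqrt 2 * |h| * (Real.cos x.1 - Real.cos x.2)) ^ 2 =
      (2 * Real.sqrt 2 * h * (Real.cos x.1 - Real.cos x.2)) ^ 2 by rw [mul_pow, mul_pow, sq_abs]; ring]
  rw [hset]
  refine (hC μ hμ _ hΔ t ht).trans (le_of_eq ?_)
  congr 1
  field_simp

end Literature.MathematicalPhysics.QuantumLattice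

end
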